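import Summits.KontsevichZagierPeriods.KontsevichZagierPeriods.Theses.TerasomaMultiplication
import Literature.NumberTheory.Transcendental.KZKernelConjectureForms
import Literature.Barriers.KontsevichZagierPeriods.PeriodEqualityDecidability

/-!
# `GammaHodgeSector` (stmt-KontsevichZagierPeriods-3742) — negative side I: the crux is a sector
of the summit; load-bearing analysis

Landed copy of §0–§2 of the crux work file `Cruxes/GammaHodgeSector/Disproof.lean`
(standing adversary `cdisprove`, gen 1):

* `gammaHodgeSector_iff` — the crux unfolded into `Admissible` / `HodgeCondition` /
  `IsCubeBetaRep` / `IsBallCubeRep`;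
* `of_summit : KontsevichZagierPeriods → GammaHodgeSector` — every instance is an instance of the
  formal period conjecture (`kzPeriodConjecture'_iff_isRational`); so `¬crux ⇒ ¬summit`
  (`summit_false_of_not`) and no evaluation kill exists;
* `gammaHodgeSector_false_without_valueEq` — `r.value = r'.value` is the ONLY load-bearing
  hypothesis (dimension-0 witness `[pt,1] ≁ [pt,2]`); everything else is summit-implied when
  dropped (`withoutEverythingButValueEq_of_summit`).
-/

noncomputable section

open MeasureTheory Set
open scoped BigOperators

namespace Summit.KontsevichZagierPeriods.GammaHodgeSectorNegative

open Literature.NumberTheory.Transcendental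
open Literature.NumberTheory.Transcendental.KZ
open Literature.ModelTheory.ExponentialFields (IsSemialgebraic isSemialgebraic_univ)
open Summit.KontsevichZagierPeriods.KontsevichZagierPeriods.Theses.TerasomaMultiplication (GammaHodgeSector)
open Literature.Barriers.KontsevichZagierPeriods.KZ (constRep constRep_value)

/-! ## §0 Vocabulary and unfolding -/

/-- Admissible exponent data of the crux: positive, non-integer rationals. [folklore] -/
def Admissible {N : ℕ} (x y : Fin N → ℚ) : Prop :=
  ∀ j, 0 < x j ∧ 0 < y j ∧ Int.fract (x j) ≠ 0 ∧ Int.fract (y j) ≠ 0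

/-- `u` is coprime to every denominator of the data. [folklore] -/
def CoprimeDen {N : ℕ} (x y : Fin N → ℚ) (u : ℕ) : Prop :=
  ∀ j, Nat.Coprime u (x j).den ∧ Nat.Coprime u (y j).den

/-- The Koblitz–Ogus sum `Σ_j ({u x_j} + {u y_j} − {u (x_j + y_j)})` of the crux at the unit `u`.
[cite: Deligne1982HodgeCycles, §7 (restatement before Thm. 7.18)] -/
def hodgeSum {N : ℕ} (x y : Fin N → ℚ) (u : ℕ) : ℚ :=
  ∑ j, (Int.fract ((u : ℚ) * x j) + Int.fract ((u : ℚ) * y j) - Int.fract ((u : ℚ) * (x j + y j)))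

/-- The Hodge-type condition of the crux (verbatim): for every `u ≥ 1` coprime to all
denominators, `hodgeSum x y u − hodgeSum x' y' u = k`. [cite: Deligne1982HodgeCycles, Thm. 7.18] -/
def HodgeCondition (N N' k : ℕ) (x y : Fin N → ℚ) (x' y' : Fin N' → ℚ) : Prop :=
  ∀ u : ℕ, 0 < u → CoprimeDen x y u → CoprimeDen x' y' u → hodgeSum x y u - hodgeSum x' y' u = (k : ℚ)

/-- `r` is pinned as the cube representation `[(0,1)^N, Π t_j^{x_j−1}(1−t_j)^{y_j−1}]`. [folklore] -/
def IsCubeBetaRep {N : ℕ} (x y : Fin N → ℚ) (r : IntegralRep N) : Prop :=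
  r.domain = {t | ∀ j, t j ∈ Ioo (0:ℝ) 1} ∧
    EqOn r.integrand (fun t => ∏ j, (t j) ^ ((x j : ℝ) - 1) * (1 - t j) ^ ((y j : ℝ) - 1)) r.domain

/-- `r'` is pinned as the representation `[unit 2k-ball × (0,1)^{N'}, c · k! · Π (…)]`. [folklore] -/
def IsBallCubeRep {N' : ℕ} (k : ℕ) (x' y' : Fin N' → ℚ) (c : ℝ) (r' : IntegralRep (2 * k + N')) : Prop :=
  r'.domain = {z | (∑ i : Fin (2 * k), (z (Fin.castAdd N' i)) ^ 2) < 1 ∧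
      ∀ l : Fin N', z (Fin.natAdd (2 * k) l) ∈ Ioo (0:ℝ) 1} ∧
    EqOn r'.integrand (fun z => c * (k.factorial : ℝ) *
      ∏ l, (z (Fin.natAdd (2 * k) l)) ^ ((x' l : ℝ) - 1) * (1 - z (Fin.natAdd (2 * k) l)) ^ ((y' l : ℝ) - 1))
      r'.domain

/-- The crux, unfolded into the vocabulary above (definitional). [folklore] -/
theorem gammaHodgeSector_iff :
    GammaHodgeSector ↔
      ∀ (N N' k : ℕ) (x y : Fin N → ℚ) (x' y' : Fin N' → ℚ) (c : ℝ),
        Admissible x y → Admissible x' y' → HodgeCondition N N' k x y x' y' → IsAlgebraic ℚ c →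
        ∀ (r : IntegralRep N) (r' : IntegralRep (2 * k + N')),
          IsCubeBetaRep x y r → IsBallCubeRep k x' y' c r' → r.value = r'.value → Equivalent r r' := by
  constructor
  · intro h N N' k x y x' y' c hx hx' hH hc r r' hr hr' hv
    exact h N N' k x y x' y' c hx hx' hH hc r r' hr.1 hr.2 hr'.1 hr'.2 hv
  · intro h N N' k x y x' y' c hx hx' hH hc r r' hd hi hd' hi' hv
    exact h N N' k x y x' y' c hx hx' hH hc r r' ⟨hd, hi⟩ ⟨hd', hi'⟩ hv

/-! ## §1 The crux resists: it is a sector of the summit -/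

/-- The part of the crux that carries all its content: the two-representation form of the
period conjecture for ALL representations (`KZPeriodConjecture'`), which the summit implies
(`kzPeriodConjecture'_iff_isRational`, one Newton–Leibniz "graph" move per side).
[cite: KontsevichZagier2001, §1.2 Conjecture 1] -/
theorem core_of_summit (h : KontsevichZagierPeriods) : KZPeriodConjecture' :=
  kzPeriodConjecture'_iff_isRational.mpr h

/-- **The summit implies the crux.** Every instance of `GammaHodgeSector` is an instance of the
formal Kontsevich–Zagier conjecture: the admissibility, Hodge-type, algebraicity and pinning
hypotheses are not used. [cite: KontsevichZagier2001, §1.2 Conjecture 1] -/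
theorem of_summit (h : KontsevichZagierPeriods) : GammaHodgeSector := by
  intro N N' k x y x' y' c _ _ _ _ r r' _ _ _ _ hv
  exact core_of_summit h r r' hv

/-- Contrapositive: a refutation of this crux refutes the summit as formalised. [folklore] -/
theorem summit_false_of_not (h : ¬ GammaHodgeSector) : ¬ KontsevichZagierPeriods :=
  fun hs => h (of_summit hs)

/-! ## §2 Load-bearing analysis: only value equality bears load -/

/-- The crux with the hypothesis `r.value = r'.value` DROPPED (everything else verbatim; negative
knowledge about the crux, not a citable proposition). -/
def GammaHodgeSectorWithoutValueEq : Prop :=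
  ∀ (N N' k : ℕ) (x y : Fin N → ℚ) (x' y' : Fin N' → ℚ) (c : ℝ),
    Admissible x y → Admissible x' y' → HodgeCondition N N' k x y x' y' → IsAlgebraic ℚ c →
    ∀ (r : IntegralRep N) (r' : IntegralRep (2 * k + N')),
      IsCubeBetaRep x y r → IsBallCubeRep k x' y' c r' → Equivalent r r'

/-- The dimension-0 rational constant `[pt, q]` is pinned as the cube representation with no
variables (`N = 0`: domain `(0,1)^0 = {pt}`, empty product `= 1`) exactly when `q = 1`… here we
only need the direction used below: `constRep 1` is such a representation. [folklore] -/
theorem isCubeBetaRep_constRep_one : IsCubeBetaRep (N := 0) Fin.elim0 Fin.elim0 (constRep 1) := by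
  refine ⟨?_, ?_⟩
  · ext t
    simp [constRep]
  · intro t _
    simp [constRep]

/-- `[pt, c]` (for rational `c`, as `constRep c`) is the ball × cube representation with
`k = 0`, `N' = 0` and constant `c`. [folklore] -/
theorem isBallCubeRep_constRep (q : ℚ) :
    IsBallCubeRep (N' := 0) 0 Fin.elim0 Fin.elim0 (q : ℝ) (constRep q) := by
  refine ⟨?_, ?_⟩
  · ext t
    simp [constRep]
  · intro t _
    simp [constRep]

/-- The Hodge-type condition holds trivially for empty data with `k = 0`. [folklore] -/
theorem hodgeCondition_empty : HodgeCondition 0 0 0 Fin.elim0 Fin.elim0 Fin.elim0 Fin.elim0 := by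
  intro u _ _ _
  simp [hodgeSum]

/-- Empty data are admissible. [folklore] -/
theorem admissible_elim0 : Admissible (N := 0) Fin.elim0 Fin.elim0 := fun j => j.elim0

/-- **Value equality is load-bearing.** Without `r.value = r'.value` the crux fails already in
dimension `0`: data `N = N' = k = 0`, `c = 2` (algebraic), `r = [pt, 1]`, `r' = [pt, 2]` satisfy
every other hypothesis, and `r ≁ r'` by soundness of the calculus (`1 ≠ 2`). Any proof must use
the value hypothesis. [folklore] -/
theorem gammaHodgeSector_false_without_valueEq : ¬ GammaHodgeSectorWithoutValueEq := by
  intro h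
  have halg : IsAlgebraic ℚ ((2 : ℚ) : ℝ) := isAlgebraic_algebraMap (2 : ℚ)
  have hE := h 0 0 0 Fin.elim0 Fin.elim0 Fin.elim0 Fin.elim0 ((2 : ℚ) : ℝ)
    admissible_elim0 admissible_elim0 hodgeCondition_empty halg (constRep 1) (constRep 2)
    isCubeBetaRep_constRep_one (isBallCubeRep_constRep 2)
  have hval := Equivalent.value_eq_holds hE
  rw [constRep_value, constRep_value] at hval
  norm_num at hval

/-- For contrast: the crux with EVERY hypothesis except value equality dropped (and the two
representations no longer pinned) is still implied by the summit — it is `KZPeriodConjecture'`.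
So admissibility, the Hodge-type test, `IsAlgebraic ℚ c` and the pinnings bear no load; they
select a sector. [cite: KontsevichZagier2001, §1.2 Conjecture 1] -/
theorem withoutEverythingButValueEq_of_summit (h : KontsevichZagierPeriods) :
    ∀ ⦃n m : ℕ⦄ (r : IntegralRep n) (r' : IntegralRep m), r.value = r'.value → Equivalent r r' :=
  core_of_summit h



end Summit.KontsevichZagierPeriods.GammaHodgeSectorNegative
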